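import Summits.Langlands.Langlands.Theorems.PicardMuOrdinaryMuOrdinaryFamilyRTThorneDefs
import Summits.Langlands.Langlands.Theorems.PicardMuOrdinaryMuOrdinaryFamilyRTThornePointGalois
import Literature.NumberTheory.GaloisRepresentations.ResidualGaloisRep
import Literature.NumberTheory.Automorphic.EssConjSelfDual
import HarnessLib

/-!
# Crux `MuOrdinaryFamilyRT` (stmt-Langlands-13757), line `thorne-minimal-lift`: the typed DEBTS of
# `stub_companions` (Defs file no. 3 of the line; companion of …ThorneDefs p137392, …ThorneDebts p141007)

Wave 2 of the line (lead prover-line-stmt-Langlands-13757-c3-0, 2026-08-17) returned `stub-blocked` for the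
automorphic stub `T.stub_companions` (ordinary automorphic companions over `F'` of every arithmetic weight near the
Picard point), with an audit (item evidence `stub_companions.md`: the statement is neither junk-satisfiable — `D = ∅`
is killed by the accumulation clause, every weight HAS a point over it by lying-over, so the companion clause is never
vacuous — nor false / mis-stated as typed: the order convention of clause (e) of `HasOrdinaryCompanion` is internally
consistent and the polarization exponent of clause (b) is reachable by a CM twist) and with the blocking statements
TYPED against the tree.  This file lands those statements — `def … : Prop` only, nothing asserted — so that the
kernel-checked reduction `stub_companions_of : Missing.hidaOrdinaryCompanions → Missing.ordinaryPolarizedSeed →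
Missing.auxiliaryCMField → Missing.arithmeticPointsNearPicard → T.stub_companions` (file …ThorneCompanionsReduction)
can follow, and so that the two PROVABLE pieces (G1, G3) can be registered as stubs of the line by name.

* § 1 clause predicates naming the clauses (a)–(e) of `HasOrdinaryCompanion` (`CompatibleOff`, `UnramifiedOff`,
  `TracePolarizedHom`, `TracePolarized`, `PotUnramifiedOn`, `EntrywiseCongruent`, `IsBorelOfWeightAt`) and the
  standing hypotheses of Hida theory on the definite unitary group (`AuxiliaryPlace` — level `Iw₁(ṽ₁)` at an auxiliary
  place makes the level sufficiently small although `ζ₃ ∈ F'`; `ThreeSplitFromMaximalReal`; `UnramifiedOverMaximalReal`),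
  and MF1 `Missing.hidaOrdinaryCompanions` — THE WALL: Hida theory on `U(3)_{F'/F'⁺}` at `GL₃/F'`-level (Geraghty,
  Math. Ann. 373 (2019) Prop. 2.5.3, Cor. 2.5.4, Lemma 2.6.4, Props. 2.7.3–2.7.4, Cor. 2.7.8, Cor. 3.1.4; Labesse 2011
  Cor. 5.3 / Thm. 5.4; Guerberoff 2011 Thm. 2.3; every step printed, the assembly at `l = n = 3`, `ζ₃ ∈ F'` not; the
  tree has no algebraic automorphic forms on a definite unitary group, no ordinary projector there, no `Λ`-adic Hecke
  algebra of `U(n)`).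
* § 2 MF2 `Missing.ordinaryPolarizedSeed` — the route-level debt: the residual-automorphy seed of route items
  stmt-Langlands-13759/13760 in the ORDINARY POLARIZED form over `F'` that Hida theory consumes.
* § 3 the glue, as statements: G1 `Missing.auxiliaryCMField` (the biquadratic `F' = ℚ(ω, √d)`, `d ≡ 6 mod 9`;
  elementary, provable) and G3 `Missing.arithmeticPointsNearPicard` (THE GALOIS SIDE of the stub: gap-dominant
  arithmetic weights of `Λ` accumulate at `x_C` and the points over them are continuous, integral, polarized and
  Borel of that weight at `w ∣ 3`; provable in principle from the `OrdFamily` axioms, Zariski density of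
  `ℚ̄₃`-points and local class field theory).
* § 4 `compatibleOff_iff` (definitional handle, registered on the crux item).
-/

set_option linter.dupNamespace false

namespace Summit.Langlands.Langlands.Cruxes.MuOrdinaryFamilyRT.ThorneMinimalLift

open scoped NumberField Polynomial Matrix Classical
open Field IsDedekindDomain Polynomial
open Literature.NumberTheory.GaloisRepresentations Literature.NumberTheory.Automorphic
open Summit.Langlands.Langlands.Cruxes.MuOrdinaryFamilyRT.CharZeroDominance

noncomputable section

/-! ## 1. The wall: Hida theory on the definite unitary group `U(3)_{F'/F'⁺}`, typed at `GL₃/F'`-level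

The clauses below are those of `HasOrdinaryCompanion` (…ThorneDefs § 2), named so that the missing fact
reads "a seed with clauses (a)–(e) ⟹ companions with clauses (a)–(e) of EVERY admissible dominant weight".
-/

section Clauses

variable (F' : Type) [Field F'] [NumberField F']

/-- Clause (a) of `HasOrdinaryCompanion`: `r` is attached to `P` (lang.S27 compatibility, tree
`IsGaloisCompatibleAt`) at the places outside `S'` and prime to `3`. -/
def CompatibleOff {hcpt' : isCompact_glFiniteIntegralLevel 3 F'} (S' : Finset (HeightOneSpectrum (𝓞 F')))
    (P : CuspidalAutomorphicRepData 3 F' hcpt') (ι : PadicAlgCl 3 ≃+* ℂ)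
    (r : FramedGaloisRep F' (PadicAlgCl 3) 3) : Prop :=
  ∀ w : HeightOneSpectrum (𝓞 F'), w ∉ S' → ((3 : ℕ) : 𝓞 F') ∉ w.asIdeal → IsGaloisCompatibleAt P.1 ι r w

/-- `r` is unramified at the places outside `S'` and prime to `3` (what the Hida family of level `S'`
delivers, and what Thorne's hypothesis (iv)(b) needs at the places where `ρ_y` is unramified; NOT a clause
of `HasOrdinaryCompanion`, whose clause (a) yields it only where `P` is known to have a Satake parameter). -/
def UnramifiedOff (S' : Finset (HeightOneSpectrum (𝓞 F'))) (r : FramedGaloisRep F' (PadicAlgCl 3) 3) : Prop :=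
  ∀ w : HeightOneSpectrum (𝓞 F'), w ∉ S' → ((3 : ℕ) : 𝓞 F') ∉ w.asIdeal → r.IsUnramifiedAt w

/-- Clause (b) of `HasOrdinaryCompanion` for a bare homomorphism `ρ : Γ_{F'} → GL₃(ℚ̄₃)`: polarized in
trace form with exponent `m`, `tr ρ(c σ c⁻¹) = ε(σ)^m · tr ρ(σ⁻¹)` for every complex conjugation `c ∈ Γ_ℚ`
(`F'/ℚ` Galois; for `F'` CM the image of `c` in `Gal(F'/ℚ)` is central, so one `c` gives all). -/
def TracePolarizedHom [IsGalois ℚ F'] (m : ℤ) (ρ : absoluteGaloisGroup F' →* GL (Fin 3) (PadicAlgCl 3)) :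
    Prop :=
  ∀ c : absoluteGaloisGroup ℚ, IsComplexConjugation (algebraMap ℚ ℝ) c →
    ∀ σ : absoluteGaloisGroup F', (ρ (absGaloisOuterConj ℚ F' c σ)).val.trace =
      algebraMap ℤ_[3] (PadicAlgCl 3) (((GaloisRep.cyclotomicCharacter F' 3 σ) ^ m : ℤ_[3]ˣ) : ℤ_[3]) *
        (ρ σ⁻¹).val.trace

/-- Clause (b) of `HasOrdinaryCompanion` for a framed (continuous) `r`, verbatim. -/
def TracePolarized [IsGalois ℚ F'] (m : ℤ) (r : FramedGaloisRep F' (PadicAlgCl 3) 3) : Prop :=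
  ∀ c : absoluteGaloisGroup ℚ, IsComplexConjugation (algebraMap ℚ ℝ) c →
    ∀ σ : absoluteGaloisGroup F', FramedRep.trace r (absGaloisOuterConj ℚ F' c σ) =
      algebraMap ℤ_[3] (PadicAlgCl 3) (((GaloisRep.cyclotomicCharacter F' 3 σ) ^ m : ℤ_[3]ˣ) : ℤ_[3]) *
        FramedRep.trace r σ⁻¹

/-- Clause (c) of `HasOrdinaryCompanion`: `r` is potentially unramified (an open subgroup of inertia
acts trivially) at the places of `S'` prime to `3`. -/
def PotUnramifiedOn (S' : Finset (HeightOneSpectrum (𝓞 F'))) (r : FramedGaloisRep F' (PadicAlgCl 3) 3) :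
    Prop :=
  ∀ w ∈ S', ((3 : ℕ) : 𝓞 F') ∉ w.asIdeal →
    ∃ U : OpenSubgroup (absoluteGaloisGroup (w.adicCompletion F')),
      ∀ τ ∈ absInertia (w.adicCompletion F'), τ ∈ U → r (absGaloisRestrict F' (w.adicCompletion F') τ) = 1

/-- Clause (d) of `HasOrdinaryCompanion`, between two representations: after a change of frame `r` is
integral and congruent ENTRYWISE to `r₀` modulo the maximal ideal of `ℤ̄₃`. -/
def EntrywiseCongruent (r r₀ : absoluteGaloisGroup F' →* GL (Fin 3) (PadicAlgCl 3)) : Prop :=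
  ∃ g : GL (Fin 3) (PadicAlgCl 3), ∀ (σ : absoluteGaloisGroup F') (i j : Fin 3),
    ‖(g⁻¹ * r σ * g).val i j‖ ≤ 1 ∧ ‖(g⁻¹ * r σ * g).val i j - (r₀ σ).val i j‖ < 1

/-- Clause (e) of `HasOrdinaryCompanion` for a bare homomorphism `ρ : Γ_{F'} → GL₃(ℚ̄₃)` at a place `w`:
`ρ|Γ_{F'_w}` is Borel in some frame, with `i`-th diagonal character `∏_τ τ(Art⁻¹ ·)^{-(λ_{τ,3-i}+i-1)}` on an
open subgroup of inertia (the shape `OrdFamily.ordinaryAt` gives the points of a family, written at a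
place of `F'`). -/
def IsBorelOfWeightAt (w : HeightOneSpectrum (𝓞 F')) (art : LocalArtinData (w.adicCompletion F'))
    (ρ : absoluteGaloisGroup F' →* GL (Fin 3) (PadicAlgCl 3))
    (wt : LabelledWeight (w.adicCompletion F') (PadicAlgCl 3) 3) : Prop :=
  ∃ (g : GL (Fin 3) (PadicAlgCl 3)) (U : OpenSubgroup (absoluteGaloisGroup (w.adicCompletion F'))),
    (∀ τ : absoluteGaloisGroup (w.adicCompletion F'),
      IsUpper3 (g⁻¹ * ρ (absGaloisRestrict F' (w.adicCompletion F') τ) * g).val) ∧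
    ∀ τw ∈ WeilGroup.inertia (w.adicCompletion F'),
      WeilGroup.toAbsGalois (w.adicCompletion F') τw ∈ U → ∀ i : Fin 3,
        (g⁻¹ * ρ (absGaloisRestrict F' (w.adicCompletion F') (WeilGroup.toAbsGalois (w.adicCompletion F') τw)) *
          g).val i i = (ordinaryWeightUnit wt i (art.artin τw) : PadicAlgCl 3)

/-- An AUXILIARY PLACE inside the level: some `v₁ ∈ S'` prime to `6`, split from `F'⁺`, at which `r₀` is
unramified with residually regular semisimple Frobenius (its characteristic polynomial is integral with
unit discriminant).  At such a place the level `Iw₁(ṽ₁)` (unipotent mod `ṽ₁`, a pro-`p₁` group, `p₁ ≠ 3`)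
makes the level SUFFICIENTLY SMALL (no `3`-torsion in the finite arithmetic groups `t⁻¹G(F'⁺)t ∩ U`, as
Geraghty Prop. 2.5.3 / Thorne 2012 Lemmas 6.3–6.4 require — with `ζ₃ ∈ F'` the central `ω·1` has order `3`,
so the devices "`N v₁ ≢ 1 mod l`" of Thorne 2012 and "`H⁰(ad r̄(1)) = 0`" of Gee–Geraghty are unavailable),
while every member of the family stays potentially unramified with `N = 0` at `ṽ₁` (a non-zero monodromy
needs two Frobenius eigenvalues of ratio `N ṽ₁ ≡ 1 mod 3`, excluded residually). -/
def AuxiliaryPlace [NumberField.IsCMField F'] (S' : Finset (HeightOneSpectrum (𝓞 F')))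
    (r₀ : FramedGaloisRep F' (PadicAlgCl 3) 3) : Prop :=
  ∃ v₁ ∈ S', ((2 : ℕ) : 𝓞 F') ∉ v₁.asIdeal ∧ ((3 : ℕ) : 𝓞 F') ∉ v₁.asIdeal ∧
    NumberField.IsCMField.complexConj F' • v₁ ≠ v₁ ∧ r₀.IsUnramifiedAt v₁ ∧
    ∃ Q : Polynomial (PadicAlgCl 3), Q.Monic ∧ (∀ i : ℕ, ‖Q.coeff i‖ ≤ 1) ∧ ‖Q.discr‖ = 1 ∧
      r₀.HasFrobCharpolyAt v₁ Q

/-- Every place of the CM field `F'` above `3` is moved by complex conjugation, i.e. the place of `F'⁺`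
below it splits in `F'/F'⁺` (Geraghty's standing hypothesis "every place of `F⁺` above `l` splits in
`F`"; for `F' = ℚ(ω, √d)`, `d ≡ 6 mod 9`, this holds with `F'_w = K_λ`). -/
def ThreeSplitFromMaximalReal [NumberField.IsCMField F'] : Prop :=
  ∀ w : HeightOneSpectrum (𝓞 F'), ((3 : ℕ) : 𝓞 F') ∈ w.asIdeal → NumberField.IsCMField.complexConj F' • w ≠ w

/-- `F'/F'⁺` is unramified at every finite place (standing hypothesis of CHT § 3.3, Geraghty § 2.1, Thorne
2012 § 6, under which the definite unitary group quasi-split at all finite places and its smooth model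
are set up; it holds for `ℚ(ω, √d)/ℚ(√d)` when `3` splits from `ℚ(√d)`). -/
def UnramifiedOverMaximalReal [NumberField.IsCMField F'] : Prop :=
  ∀ w : HeightOneSpectrum (𝓞 F'), w.asIdeal.ramificationIdx (𝓞 (NumberField.maximalRealSubfield F')) = 1

end Clauses

/-- **MF1 — `Missing.hidaOrdinaryCompanions` (THE WALL): every admissible dominant weight is the weight
of an ordinary polarized cuspidal companion congruent to a given ordinary polarized cuspidal seed — Hida
theory on the definite unitary group `U(3)_{F'/F'⁺}` transferred to `GL₃/F'`; ABSENT from the tree.**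
Let `F'` be a CM field containing `K = ℚ(ζ₃)`, Galois over `ℚ`, `F'/F'⁺` unramified at all finite places,
every place above `3` split from `F'⁺`; `S'` a level, `m ∈ ℤ`.  SEED: a regular algebraic cuspidal `P₀` on `GL₃(𝔸_{F'})` and an
integral framed `r₀ : Γ_{F'} → GL₃(ℤ̄₃)` attached to `P₀` off `S' ∪ {3}` (clause (a)) and unramified there,
polarized in trace form with exponent `m` (b), potentially unramified on `S' ∖ 3` (c), residually
absolutely irreducible, ordinary at every `w ∣ 3` of some DOMINANT weight (canonical Artin datum), and with
an auxiliary place inside `S'` (`AuxiliaryPlace`).  CONCLUSION: for every family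
of dominant weights `(λ_w)_{w ∣ 3}` that is the weight family of SOME homomorphism `Γ_{F'} → GL₃(ℚ̄₃)`
polarized with exponent `m` (this makes `λ_{cw}` the `m`-dual conjugate of `λ_w`), there are a regular
algebraic cuspidal `P` and an `r` attached to it off `S' ∪ {3}` and unramified there, polarized with the
SAME exponent `m`, potentially unramified on `S' ∖ 3`, integral and ENTRYWISE congruent to `r₀` after a
change of frame (d), and ordinary of weight EXACTLY `λ_w` at every `w ∣ 3` (e).
Proof in print (each step printed; the assembly, at `l = n = 3` with `ζ₃ ∈ F'`, is not — no automorphy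
lifting is involved): twist by an algebraic Hecke character `θ` with `θθ^c = ε^{m+2}` to exponent
`1 - n = -2`; `P₀ ⊗ θ⁻¹` is RACSDC, descends to the definite unitary group `G` (Labesse 2011 Thm. 5.4) and is
`ι`-ordinary (`r` ordinary ⇒ `π` `ι`-ordinary: Geraghty Lemmas 5.1.6/5.2.1 = BLGGT § 2.1, fourth bullet, when
the level is potentially prime to `l` — the case of the intended seed of MF2, `Sym²` of a `3`-old ordinary
member twisted by a potentially crystalline CM character; for a seed with `N ≠ 0` at `w ∣ 3` this step is
folklore via Caraiani's `l = p` compatibility, no printed locator found), giving a non-Eisenstein maximal ideal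
`𝔪` of the universal ordinary Hecke algebra `𝕋^{T,ord}(U(𝔩^∞), 𝒪)` (Geraghty Def. 2.6.2) at the level `U`
which is `Iw₁(ṽ₁)` at the auxiliary place (sufficiently small) and carries at `ṽ ∈ S' ∖ 3` the seed's
Bushnell–Kutzko type made spherical on multiplicity blocks (so every member is generic with `N = 0` there,
by Caraiani's `ℓ ≠ p` compatibility — this delivers (c); the twisting character below is unramified outside
`3` because `ζ₃ ∈ F'`: powers of the Grössencharacter of the conductor-`27` CM curve composed with the norm
to `ℚ(ζ₃)`, residually trivial); `S^{ord}(U(𝔩^∞), K/𝒪)^∨` is finite FREE over the LOCAL ring `Λ = 𝒪⟦T₃(𝔩)⟧`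
(Prop. 2.5.3,
Thorne 2012 Prop. 8.2; `𝕋^{ord}` finite faithful, Cor. 2.5.4), hence so is its direct summand at `𝔪`, so
`𝕋^{ord}_𝔪` has `ℚ̄₃`-points over EVERY arithmetic prime `℘_λ` (the prime-to-`3` nebentype being absorbed at
level `𝔩^{1,1}`); by control (Lemma 2.6.4 with Cor. 2.5.4 = Gee–Geraghty Prop. 4.3.2: `𝕋^{ord} ⊗_Λ κ(℘_λ) ↠
𝕋^{ord}_λ(U(𝔩^{1,1}), 𝒪) ⊗ K` with nilpotent kernel, `λ` dominant) such a point is an ordinary eigenform of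
weight `λ`, i.e. (Lemma 2.2.5 = CHT Prop. 3.3.2 = Thorne 2012 Prop. 6.2) an automorphic `σ` of `G(𝔸_{F'⁺})`,
whose base change `Π` to `GL₃(𝔸_{F'})` (Labesse Cor. 5.3; cuspidal since `r̄_𝔪` is absolutely irreducible)
is RACSDC with `r_{3,ι}(Π)` lifting `r̄_𝔪` (Guerberoff Thm. 2.3 / CHT Prop. 3.4.2 = Thorne 2012 Thm. 6.5,
Props. 6.6, 8.4–8.5) and ORDINARY OF WEIGHT `λ_w` at `w` (Cor. 3.1.4: `r_𝔪` is `Λ`-adically ordinary;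
equivalently Lemma 2.7.6 + Cor. 2.7.8 / Prop. 5.3.1 = BLGGT § 2.1 "`ι`-ordinary ⇒ ordinary"), of the
`-2`-dual conjugate weight at `cw`; twist back by `θ` (weights shift labelwise, residual representation and
entrywise congruence preserved after choosing `θ̄ = 1`, exponent back to `m`).  ABSENT from the tree:
algebraic automorphic forms `S_λ(U, A)` on a definite unitary group (the tree's `UnitaryGroup.*` is Mok's
quasi-split group with `ℂ`-valued forms), `U_λ`-operators and ordinary projector there, the `Λ`-adic Hecke
algebra of `U(n)` and its Galois representations; the tree's Hida theory (`OrdinaryCompletedCohomologyGL`,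
`HidaTower*`, `POrdinaryHeckeAlgebraGL2`, `BianchiOrdinaryClassicality`) is Betti cohomology of `GL_n`,
where arithmetic points are not Zariski dense for `GL₃` over a CM field (`l₀ > 0`; cf.
`CalegariNonParallelOrdinary`).
[Geraghty, Math. Ann. 373 (2019) 1341–1427, Def. 2.2.3, Lemma 2.2.5, § 2.4, Prop. 2.5.3, Cor. 2.5.4,
Def. 2.6.2, Lemma 2.6.4, Props. 2.7.3–2.7.4, Lemma 2.7.6, Cor. 2.7.8, Cor. 3.1.4, Lemmas 5.1.6/5.2.1,
Prop. 5.3.1 (paywalled, acq-02323; locators as cited in the held texts following); Gee–Geraghty, Duke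
Math. J. 161 (2012) §§ 4.2–4.3, Prop. 4.3.2, § 5.1, proof of Thm. 6.1.2 (arXiv:1001.2044 pp. 12–14, 16,
20); Thorne, J. Inst. Math. Jussieu 11 (2012) Prop. 6.2, Thm. 6.5, Props. 6.6–6.7, Def. 8.1, Prop. 8.2,
Def. 8.3, Props. 8.4–8.5 (arXiv:1107.5989 pp. 19–21, 26–27); Thorne, J. Amer. Math. Soc. 28 (2015) § 2
(as cited in Allen–Newton–Thorne, Compos. Math. 156 (2020) p. 4 and § 4.1, arXiv:1912.11269 pp. 4, 14);
Labesse, *Changement de base CM et séries discrètes* (2011) Cor. 5.3, Thm. 5.4; Guerberoff, Compos. Math.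
147 (2011) Thm. 2.3; Barnet-Lamb–Gee–Geraghty–Taylor, Ann. Math. 179 (2014) § 2.1 (arXiv:1010.2561
p. 18); Caraiani, Duke Math. J. 161 (2012); Alg. Number Theory 8 (2014)] -/
def Missing.hidaOrdinaryCompanions : Prop :=
  ∀ (F' : Type) [Field F'] [NumberField F'] [Algebra K F'] [IsGalois ℚ F'] [NumberField.IsCMField F']
    (ι : PadicAlgCl 3 ≃+* ℂ) (hcpt' : isCompact_glFiniteIntegralLevel 3 F')
    (S' : Finset (HeightOneSpectrum (𝓞 F'))) (m : ℤ),
    UnramifiedOverMaximalReal F' → ThreeSplitFromMaximalReal F' →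
    -- THE SEED
    ∀ (P₀ : CuspidalAutomorphicRepData 3 F' hcpt') (r₀ : FramedGaloisRep F' (PadicAlgCl 3) 3),
      P₀.1.IsRegularAlgebraic → r₀.IsResiduallyAbsIrreducible →
      CompatibleOff F' S' P₀ ι r₀ → UnramifiedOff F' S' r₀ → TracePolarized F' m r₀ →
      PotUnramifiedOn F' S' r₀ → AuxiliaryPlace F' S' r₀ →
      (∀ (σ : absoluteGaloisGroup F') (i j : Fin 3), ‖(r₀ σ).val i j‖ ≤ 1) →
      (∀ w : HeightOneSpectrum (𝓞 F'), ((3 : ℕ) : 𝓞 F') ∈ w.asIdeal →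
        ∀ art : LocalArtinData (w.adicCompletion F'), art.IsCanonical →
          ∃ wt₀ : LabelledWeight (w.adicCompletion F') (PadicAlgCl 3) 3,
            wt₀.IsDominant ∧ r₀.IsOrdinaryOfLabelledWeightAt w art wt₀) →
    -- EVERY ADMISSIBLE DOMINANT WEIGHT FAMILY HAS A COMPANION OF EXACTLY THAT WEIGHT
    ∀ (wt : (w : HeightOneSpectrum (𝓞 F')) → LabelledWeight (w.adicCompletion F') (PadicAlgCl 3) 3),
      (∀ w : HeightOneSpectrum (𝓞 F'), ((3 : ℕ) : 𝓞 F') ∈ w.asIdeal → (wt w).IsDominant) →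
      (∃ ρ : absoluteGaloisGroup F' →* GL (Fin 3) (PadicAlgCl 3), TracePolarizedHom F' m ρ ∧
        ∀ w : HeightOneSpectrum (𝓞 F'), ((3 : ℕ) : 𝓞 F') ∈ w.asIdeal →
          ∀ art : LocalArtinData (w.adicCompletion F'), art.IsCanonical → IsBorelOfWeightAt F' w art ρ (wt w)) →
      ∃ (P : CuspidalAutomorphicRepData 3 F' hcpt') (r : FramedGaloisRep F' (PadicAlgCl 3) 3),
        P.1.IsRegularAlgebraic ∧ CompatibleOff F' S' P ι r ∧ UnramifiedOff F' S' r ∧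
        TracePolarized F' m r ∧ PotUnramifiedOn F' S' r ∧
        EntrywiseCongruent F' (r : absoluteGaloisGroup F' →* GL (Fin 3) (PadicAlgCl 3)) r₀ ∧
        ∀ w : HeightOneSpectrum (𝓞 F'), ((3 : ℕ) : 𝓞 F') ∈ w.asIdeal →
          ∀ art : LocalArtinData (w.adicCompletion F'), art.IsCanonical →
            r.IsOrdinaryOfLabelledWeightAt w art (wt w)

/-! ## 2. The route-level debt: the residual-automorphy seed in ordinary polarized form over `F'` -/

/-- **MF2 — `Missing.ordinaryPolarizedSeed` (route items stmt-Langlands-13759/13760, STRENGTHENED to the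
form Hida theory consumes; a route-level statement, not a printed theorem).**  For `(f, ρ_C)` in the main
class, a family `𝓕` through it, and every admissible auxiliary field `F'` (Galois CM quadratic over `K`
keeping the image of the heart, `F'/F'⁺` unramified at finite places with `3` split): there are a level `S'`
containing the places above `S₀` and an auxiliary place, a regular algebraic cuspidal `P₀` on `GL₃(𝔸_{F'})`
and an integral framed `r₀` attached to it off `S' ∪ {3}` and unramified there, polarized in trace form
with the FAMILY'S exponent `𝓕.m`, potentially unramified on `S' ∖ 3`, residually absolutely irreducible,
reducing ENTRYWISE to the heart `r̄_f^B|Γ_{F'}` (the residual representation of every point of the family,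
`𝓕.residual`), and ordinary at every `w ∣ 3` of some dominant weight.  Intended witness (route card):
`P₀ = BC_{F'/K}(BC_{K/ℚ}(Sym² g) ⊗ χ_g⁻¹[sgn]) ⊗ θ` for the `3`-ordinary weight-`2` member `g` of the
octahedral Hida family through the Langlands–Tunnell weight-one form of the projective `S₄` representation
(odd branch; `Sym² ρ_g ⊗ χ_g⁻¹` is polarized with exponent `-2` and reduces to `Ad⁰ ρ̄_g = r̄_f ⊗ sgn`),
resp. the cubic automorphic induction (totally real branch), `θ` a CM character of `F' ⊃ K` with
`θθ^c = ε^{m+2}`, unramified outside `3` and residually trivial (powers of the Grössencharacter of the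
conductor-`27` CM curve `x³ + y³ = 1`, whose values at Frobenius are the primary generators `π ≡ 1 mod 3`,
composed with `N_{F'/K}`).  What the typed items do NOT give: ordinarity of `P₀` at `λ` (is `g` `3`-ordinary? `3` may divide the level of the
weight-one form), the polarization with exponent exactly `m`, the level/potential unramifiedness at `S'`,
entrywise (not just characteristic-polynomial) reduction.  NOT needed for the stub as typed (only for
Thorne's `∼` at `w ∣ 3` via potential diagonalizability, a neighbour's concern): agreement of the ordinary
refinement of `P₀` at `λ` with the `μ`-ordinary flag of `ρ_C` when `r̄_f|Γ_{K_λ}` has several flags.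
[route-Langlands-PicardMuOrdinary items 13759/13760; Gelbart–Jacquet, ASENS 11 (1978); Arthur–Clozel,
Ann. Math. Studies 120 (1989); Hida, Invent. Math. 85 (1986); BLGGT 2014 § 2.1] -/
def Missing.ordinaryPolarizedSeed : Prop :=
  ∀ (f : ℤ[X]) (ι : PadicAlgCl 3 ≃+* ℂ) (e : K →+* ℂ) (S₀ : Finset (HeightOneSpectrum (𝓞 K)))
    (ρC : FramedGaloisRep K (PadicAlgCl 3) 3) (𝓕 : OrdFamily f ι e S₀ ρC),
    Generic f → PicardInput f ι e S₀ ρC → MainClassPlus f S₀ ρC → PotUnramifiedFamily 𝓕 →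
  ∀ (F' : Type) [Field F'] [NumberField F'] [Algebra K F'] [IsGalois ℚ F'] [NumberField.IsCMField F']
    (hcpt' : isCompact_glFiniteIntegralLevel 3 F'),
    Module.finrank K F' = 2 →
    ((rbar f 𝓕.B).comp (absGaloisRestrict K F').toMonoidHom).range = (rbar f 𝓕.B).range →
    UnramifiedOverMaximalReal F' → ThreeSplitFromMaximalReal F' →
    ∃ (S' : Finset (HeightOneSpectrum (𝓞 F'))) (P₀ : CuspidalAutomorphicRepData 3 F' hcpt')
      (r₀ : FramedGaloisRep F' (PadicAlgCl 3) 3),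
      (∀ w : HeightOneSpectrum (𝓞 F'), w.under (𝓞 K) ∈ S₀ → w ∈ S') ∧
      P₀.1.IsRegularAlgebraic ∧ r₀.IsResiduallyAbsIrreducible ∧
      CompatibleOff F' S' P₀ ι r₀ ∧ UnramifiedOff F' S' r₀ ∧ TracePolarized F' 𝓕.m r₀ ∧
      PotUnramifiedOn F' S' r₀ ∧ AuxiliaryPlace F' S' r₀ ∧
      -- integral, reducing entrywise to the heart over `F'` in the residual frame `B`
      (∀ (σ : absoluteGaloisGroup F') (i j : Fin 3), ‖(r₀ σ).val i j‖ ≤ 1 ∧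
        ‖(r₀ σ).val i j - (ZMod.cast ((rbar f 𝓕.B (absGaloisRestrict K F' σ)).val i j) : PadicAlgCl 3)‖
          < 1) ∧
      (∀ w : HeightOneSpectrum (𝓞 F'), ((3 : ℕ) : 𝓞 F') ∈ w.asIdeal →
        ∀ art : LocalArtinData (w.adicCompletion F'), art.IsCanonical →
          ∃ wt₀ : LabelledWeight (w.adicCompletion F') (PadicAlgCl 3) 3,
            wt₀.IsDominant ∧ r₀.IsOrdinaryOfLabelledWeightAt w art wt₀)

/-! ## 3. The two Galois-side / elementary glue statements (NOT literature; sub-stubs of the line) -/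

/-- **G1 — `Missing.auxiliaryCMField` (elementary glue, provable; the planner's choice of `d`).**  For
`(f, ρ_C)` in the main class and any family `𝓕` there is an auxiliary field `F'` with all the properties
the stub and MF1/MF2 ask for: a CM field, Galois (indeed biquadratic) over `ℚ`, quadratic over `K`, over
which the heart keeps its image, with `F'/F'⁺` unramified at all finite places and every place above `3`
split from `F'⁺` (the level `S'` is produced by MF2 together with the seed).  Intended witness:
`F' = K(√d) = ℚ(ω, √d)` with `d > 0` squarefree, `d ≡ 6 mod 9` (then `3 = 𝔭²` in `F'⁺ = ℚ(√d)` and `𝔭`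
splits in `F' = F'⁺(√-3)` since `-d/3 ≡ 1 mod 3`, so `F'_w = K_λ` and `F'/F'⁺` is unramified at `𝔭`, hence
everywhere), `(d/p) = -1` for the primes `p ≡ 2 mod 3` below `S₀` (so that those places too split in
`F'/F'⁺`), and `ℚ(√d) ⊄ K(f)` (so `r̄_f(Γ_{F'}) = r̄_f(Γ_K) = S₄`); infinitely many such `d` by the Chinese
remainder theorem.  Absent as a construction (instances `Field/NumberField/IsGalois ℚ/IsCMField` for the
biquadratic field, splitting of primes in it); elementary. -/
def Missing.auxiliaryCMField : Prop :=
  ∀ (f : ℤ[X]) (ι : PadicAlgCl 3 ≃+* ℂ) (e : K →+* ℂ) (S₀ : Finset (HeightOneSpectrum (𝓞 K)))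
    (ρC : FramedGaloisRep K (PadicAlgCl 3) 3) (𝓕 : OrdFamily f ι e S₀ ρC),
    Generic f → PicardInput f ι e S₀ ρC → MainClassPlus f S₀ ρC →
    ∃ (F' : Type) (_ : Field F') (_ : NumberField F') (_ : Algebra K F') (_ : IsGalois ℚ F')
      (_ : NumberField.IsCMField F'),
      Module.finrank K F' = 2 ∧
      ((rbar f 𝓕.B).comp (absGaloisRestrict K F').toMonoidHom).range = (rbar f 𝓕.B).range ∧
      UnramifiedOverMaximalReal F' ∧ ThreeSplitFromMaximalReal F'

/-- **G3 — `Missing.arithmeticPointsNearPicard` (THE GALOIS SIDE OF THE STUB; a sub-stub of the line, not a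
literature fact).**  For a module-finite family of dimension `≥ 4` through the Picard point and an auxiliary
quadratic `F'/K` with `3` split from `F'⁺` (so `F'_w = K_λ`): there are a finite `E/ℚ₃` and a set `D` of
`E`-integral weights of `Λ` accumulating `3`-adically at the Picard weight such that every `ℚ̄₃`-point `y` of
`𝓕.R` over `D` is `𝔪_R`-adically continuous and integral, `ρ_y|Γ_{F'}` is polarized in trace form with the
family's exponent `m`, and at every `w ∣ 3` it is Borel with diagonal inertial characters those of a
labelled weight with gaps `≥ 2` (chosen uniformly in the canonical Artin datum).  Intended proof:
`D :=` the weights `κ` of `Λ` whose three inertial characters `κ ∘ wt v i` are, on an open subgroup of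
`I_{K_λ}`, the algebraic characters `∏_τ τ(Art⁻¹ ·)^{-h_{τ,i}}` with `h_{τ,0} < h_{τ,1} < h_{τ,2}` IN THE
FAMILY'S ROW ORDER, gaps `≥ 3`, `h ≡` (exponents at `x_C`) `mod 2·3^M` — such `κ` exist and accumulate at
`κ_C` because `Spec Λ` IS the `m`-polarized weight space of its residual nebentype (`dim Λ = 4` by
`dim_le` + finiteness + `4 ≤ dim R`; `weightsGenerate`; the polarization relation `wt₂ = ε^m (wt₀^c)⁻¹`,
`wt₁ wt₁^c = ε^m` holds identically in the domain `R` since it holds at the Zariski-dense `ℚ̄₃`-points), and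
the `ends` shape of `x_C` is compatible with increasing order in either case `i = 0` or `i = 2`
(congruence classes mod `2·3^M` contain arbitrarily large and small integers); points over `κ ∈ D` exist
(`exists_point_over`) and are automatically continuous and integral (`R` finite over the complete local
`Λ`, Artin–Rees; `κ` is local by Hensel: principal units of `Λ` are `n`-th powers for `3 ∤ n`); Borel
shape from `ordinaryAt`, transported from `K_λ` to `F'_w` along conjugate decomposition groups;
polarization from `𝓕.polarized` pushed through `y` (complex conjugation is central in `Gal(F'/ℚ)`).
Needs local class field theory for `K_λ` (tree: `LocalArtinData`, named facts `exists_isLocalArtinMap`,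
`IsLocalArtinMap.unique`) and the structure `𝒪_{K_λ}^× ≅ μ₂ × μ₃ × ℤ₃²`. -/
def Missing.arithmeticPointsNearPicard : Prop :=
  ∀ (f : ℤ[X]) (ι : PadicAlgCl 3 ≃+* ℂ) (e : K →+* ℂ) (S₀ : Finset (HeightOneSpectrum (𝓞 K)))
    (ρC : FramedGaloisRep K (PadicAlgCl 3) 3) (𝓕 : OrdFamily f ι e S₀ ρC),
    Generic f → PicardInput f ι e S₀ ρC → MainClassPlus f S₀ ρC →
    ((4 : ℕ) : WithBot ℕ∞) ≤ ringKrullDim 𝓕.R → PotUnramifiedFamily 𝓕 → Module.Finite 𝓕.Λ 𝓕.R →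
  ∀ (F' : Type) [Field F'] [NumberField F'] [Algebra K F'] [IsGalois ℚ F'] [NumberField.IsCMField F'],
    Module.finrank K F' = 2 → ThreeSplitFromMaximalReal F' →
    ∃ (D : Set (𝓕.Λ →+* PadicAlgCl 3)) (E : IntermediateField ℚ_[3] (PadicAlgCl 3)),
      FiniteDimensional ℚ_[3] E ∧
      (∀ κ ∈ D, ∀ a : 𝓕.Λ, κ a ∈ E ∧ ‖κ a‖ ≤ 1) ∧
      (∀ M : ℕ, ∃ κ ∈ D, ∀ a : 𝓕.Λ,
        ‖κ a - 𝓕.j (𝓕.x (algebraMap 𝓕.Λ 𝓕.R a))‖ ≤ ((3 : ℝ)⁻¹) ^ M) ∧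
      ∀ y : 𝓕.R →+* PadicAlgCl 3, y.comp (algebraMap 𝓕.Λ 𝓕.R) ∈ D →
        (∀ N : ℕ, ∃ M : ℕ, ∀ r ∈ IsLocalRing.maximalIdeal 𝓕.R ^ M, ‖y r‖ ≤ ((3 : ℝ)⁻¹) ^ N) ∧
        (∀ r : 𝓕.R, ‖y r‖ ≤ 1) ∧
        TracePolarizedHom F' 𝓕.m ((pointRep 𝓕 y).comp (absGaloisRestrict K F').toMonoidHom) ∧
        ∃ wt : (w : HeightOneSpectrum (𝓞 F')) → LabelledWeight (w.adicCompletion F') (PadicAlgCl 3) 3,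
          ∀ w : HeightOneSpectrum (𝓞 F'), ((3 : ℕ) : 𝓞 F') ∈ w.asIdeal →
            (∀ τ (i j : Fin 3), i < j → wt w τ j + 2 ≤ wt w τ i) ∧
            ∀ art : LocalArtinData (w.adicCompletion F'), art.IsCanonical →
              IsBorelOfWeightAt F' w art ((pointRep 𝓕 y).comp (absGaloisRestrict K F').toMonoidHom) (wt w)


/-! ## 4. Definitional handle -/

/-- `CompatibleOff` unfolds to clause (a) of `HasOrdinaryCompanion` (definitional handle through which the clause
predicates of this file are tied to the crux item). -/
theorem compatibleOff_iff : ∀ (F' : Type) [Field F'] [NumberField F'] {hcpt' : isCompact_glFiniteIntegralLevel 3 F'} (S' : Finset (HeightOneSpectrum (𝓞 F'))) (P : CuspidalAutomorphicRepData 3 F' hcpt') (ι : PadicAlgCl 3 ≃+* ℂ) (r : FramedGaloisRep F' (PadicAlgCl 3) 3), CompatibleOff F' S' P ι r ↔ ∀ w : HeightOneSpectrum (𝓞 F'), w ∉ S' → ((3 : ℕ) : 𝓞 F') ∉ w.asIdeal → IsGaloisCompatibleAt P.1 ι r w :=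
  fun _ _ _ _ _ _ _ _ => Iff.rfl

end

end Summit.Langlands.Langlands.Cruxes.MuOrdinaryFamilyRT.ThorneMinimalLift
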